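import Summits.ResolutionOfSingularities.ResolutionOfSingularities.Theorems.HilbertSamuelEliminationCampaignW42NearChainMovingClosed
import Summits.ResolutionOfSingularities.ResolutionOfSingularities.Theorems.HilbertSamuelEliminationSigmaMaxModificationsCorridor3RegularValue
import HarnessLib

/-!
# [OURS · L1 W4.2] The O2-type items as EXACT equivalences: `NearChainTermination p ↔ ∀ N, Moving.MaxOriginNoMovingNearChainAt p N ⊤`
# and `TertiaryTermination p ↔ ∀ e, TertiaryTerminationMovingAt p e ↔ ∀ e, TertiaryInvariantLaxExists p e` (the latter two modulo CJS Thm. 3.10 (4))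

Cell res-hironaka, slot W4.2 (★L-G4), statement campaign s42, seat res-L1-s42-pv-2 (gen 3); host route HilbertSamuelElimination (DRAFT); pure proofs
(`--supports stmt-ResolutionOfSingularities-19964`). AI bookkeeping, weaker than expert review. NOTHING here is a statement of H. Hironaka's manuscript
[Hironaka2017]; no new definition; nothing asserted — the items are OPEN and appear on both sides of `↔`.

The degenerate value `ν = Φ^{(N)}` (maximal only when `X` is regular) is now discharged FACT-FREE in the tree by res-L1-w42-stub-1's Φ-lemma
`IsMaximalOrigin.noNearChainFrom_of_eq_iterPSum` (p504161, `…Corridor3RegularValue.lean`): NO infinite chain of canonical near steps of any grade from a maximal origin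
with `ν = Φ^{(N)}`, for every admissible oracle. Together with the off-`Φ` theorems of `…NearChainMoving` / `…NearChainMovingClosed` (p499679, p501459, p503665; L∞ =
`WLadder.stub_movingCompactness` p500208) this makes the calibration of the two items EXACT:

* `nearChainTermination_iff_movingRows : NearChainTermination p ↔ ∀ N, Moving.MaxOriginNoMovingNearChainAt p N ⊤` — item 19964 IS the all-level starvation-free WB.
* `forall_nearChainTermination_iff` — the same for the filed form `∀ p prime, …` (stmt-ResolutionOfSingularities-19964 verbatim on the left).
* `tertiaryTermination_iff_movingAt (h310) : TertiaryTermination p ↔ ∀ e, TertiaryTerminationMovingAt p e` and `tertiaryTermination_iff_laxSlots (h310) :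
  TertiaryTermination p ↔ ∀ e, TertiaryInvariantLaxExists p e` (value universe `u + 2`, as in p476789's `tertiaryInvariantLaxExists_iff`) — item 19965 IS «a
  Cossart–Schober-shaped lax tertiary invariant exists at every grade», modulo the printed CJS Thm. 3.10 (4) (statement-only, p499783) for the `ē`-monotonicity.

References: CJS LNM 2270 §1.3, Thm. 3.10 (4), Rem. 6.29 (1), p. 107, App. Facts 18.28 (1) [CossartJannsenSaito2020]; tree p474474, p476789, p487178, p499679, p500208,
p500936, p501459, p504161.
-/

noncomputable section

set_option linter.dupNamespace false -- mandated namespace of this single-conjunct summit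

open CategoryTheory AlgebraicGeometry TopologicalSpace Topology

namespace Summit.ResolutionOfSingularities.ResolutionOfSingularities.Theorems

namespace CampaignW42

open Literature.AlgebraicGeometry.Resolution Literature.RingTheory.HilbertSamuel
open Summit.ResolutionOfSingularities.ResolutionOfSingularities.Theorems.SigmaMaxModificationsCorridor3
open Summit.ResolutionOfSingularities.ResolutionOfSingularities.Theorems.SigmaMaxModificationsCorridor3.Moving
open Summit.ResolutionOfSingularities.ResolutionOfSingularities.Theorems.SigmaMaxModificationsCorridor3.Helpers
  (geomDirDimNonincrease_of_thm_3_10_4)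
open Summit.ResolutionOfSingularities.ResolutionOfSingularities.Cruxes.SigmaMaxModificationsCorridor3.WLadder (stub_movingCompactness)

universe u

variable {p : ℕ}

/-! ## Item 19964 as an exact equivalence -/

/-- **ITEM 19964 FROM THE ALL-LEVEL MOVING ROWS, all values `ν`** (Φ-lemma for `ν = Φ^{(N)}`, L∞ + p499679 off it).
[cite: CossartJannsenSaito2020, Rem. 6.29 (1), p. 107] -/
theorem nearChainTermination_of_movingRows₀ (hM : ∀ N, MaxOriginNoMovingNearChainAt.{0} p N fun _ => True) :
    NearChainTermination.{0} p := by
  intro R hRf hRa N ν X _ x hX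
  by_cases hν : ν = iterPSum N Phi
  · exact hX.noNearChainFrom_of_eq_iterPSum hRa hν _
  · exact nearChainTermination_offPhi_of_movingRows₀ hM R hRf hRa N ν X x hX hν

/-- **`NearChainTermination p ↔ ∀ N, Moving.MaxOriginNoMovingNearChainAt p N ⊤`** — item 19964 IS the all-level starvation-free WB (universe `0`, where L∞ lives).
Nothing asserted: both sides are OPEN from dimension three (obstruction O2). [cite: CossartJannsenSaito2020, §1.3, Rem. 6.29 (1), p. 107] -/
theorem nearChainTermination_iff_movingRows :
    NearChainTermination.{0} p ↔ ∀ N, MaxOriginNoMovingNearChainAt.{0} p N fun _ => True :=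
  ⟨fun h N => maxOriginNoMoving_top_of_nearChainTermination h N, nearChainTermination_of_movingRows₀⟩

/-- **The filed item stmt-ResolutionOfSingularities-19964 verbatim on the left**: `(∀ p prime, NearChainTermination p) ↔ (∀ p prime, ∀ N, MaxOriginNoMovingNearChainAt p N ⊤)`.
[cite: CossartJannsenSaito2020, §1.3, p. 107] -/
theorem forall_nearChainTermination_iff :
    (∀ p : ℕ, p.Prime → NearChainTermination.{0} p) ↔
      ∀ p : ℕ, p.Prime → ∀ N, MaxOriginNoMovingNearChainAt.{0} p N fun _ => True :=
  ⟨fun h p hp => nearChainTermination_iff_movingRows.mp (h p hp), fun h p hp => nearChainTermination_iff_movingRows.mpr (h p hp)⟩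

/-! ## Item 19965 as an exact equivalence modulo CJS Thm. 3.10 (4) -/

/-- **ITEM 19965 FROM THE GRADED MOVING STATEMENTS, all values `ν`, modulo CJS Thm. 3.10 (4)** (an isolated origin is a maximal origin: Φ-lemma for
`ν = Φ^{(N)}`; p501459 off it). [cite: CossartJannsenSaito2020, Thm. 3.10 (4), p. 107] -/
theorem tertiaryTermination_of_movingAt₀ (h310 : CossartJannsenSaito2020_thm_3_10_4.{0}) (hmov : ∀ e, TertiaryTerminationMovingAt.{0} p e) :
    TertiaryTermination.{0} p := by
  intro R hRf hRa N ν X _ x hX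
  by_cases hν : ν = iterPSum N Phi
  · exact hX.isMaximalOrigin.noNearChainFrom_of_eq_iterPSum hRa hν _
  · exact tertiaryTermination_offPhi_of_movingAt₀ h310 hmov R hRf hRa N ν X x hX hν

/-- **`TertiaryTermination p ↔ ∀ e, TertiaryTerminationMovingAt p e`, modulo CJS Thm. 3.10 (4)** — waiting chains carry no content: the isolated O2 item is its
graded MOVING part. [cite: CossartJannsenSaito2020, Thm. 3.10 (4), p. 107] -/
theorem tertiaryTermination_iff_movingAt (h310 : CossartJannsenSaito2020_thm_3_10_4.{0}) :
    TertiaryTermination.{0} p ↔ ∀ e, TertiaryTerminationMovingAt.{0} p e :=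
  ⟨movingAt_of_tertiaryTermination, tertiaryTermination_of_movingAt₀ h310⟩

/-- **`TertiaryTermination p ↔ ∀ e, TertiaryInvariantLaxExists p e`, modulo CJS Thm. 3.10 (4)** — item 19965 IS «a Cossart–Schober-shaped lax tertiary invariant
(non-increasing along canonical near steps inside the grade, dropping when the marked point is blown up) exists at every grade», the slot form of p474474 with
p476789's `tertiaryInvariantLaxExists_iff` (value universe `u + 2`). [cite: CossartJannsenSaito2020, §1.3, Thm. 3.10 (4), p. 107, App. Facts 18.28 (1)] -/
theorem tertiaryTermination_iff_laxSlots (h310 : CossartJannsenSaito2020_thm_3_10_4.{0}) :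
    TertiaryTermination.{0} p ↔ ∀ e, TertiaryInvariantLaxExists.{0, 2} p e :=
  ⟨fun h e => tertiaryInvariantLaxExists_iff.mpr (movingAt_of_tertiaryTermination h e),
    fun h => tertiaryTermination_of_movingAt₀ h310 fun e => tertiaryInvariantLaxExists_iff.mp (h e)⟩

/-- **The filed item stmt-ResolutionOfSingularities-19965 verbatim on the left, modulo CJS Thm. 3.10 (4)**:
`(∀ p prime, TertiaryTermination p) ↔ (∀ p prime, ∀ e, TertiaryInvariantLaxExists p e)`. [cite: CossartJannsenSaito2020, §1.3, Thm. 3.10 (4)] -/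
theorem forall_tertiaryTermination_iff_laxSlots (h310 : CossartJannsenSaito2020_thm_3_10_4.{0}) :
    (∀ p : ℕ, p.Prime → TertiaryTermination.{0} p) ↔ ∀ p : ℕ, p.Prime → ∀ e, TertiaryInvariantLaxExists.{0, 2} p e :=
  ⟨fun h p hp => (tertiaryTermination_iff_laxSlots h310).mp (h p hp), fun h p hp => (tertiaryTermination_iff_laxSlots h310).mpr (h p hp)⟩

end CampaignW42

end Summit.ResolutionOfSingularities.ResolutionOfSingularities.Theorems

end
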